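import Literature.RingTheory.FittingIdeal.BaseChange
import Literature.RingTheory.FittingIdeal.Functoriality
import Mathlib.RingTheory.Etale.Kaehler
import HarnessLib

/-!
# The singular scheme `V(Fitt Ω)` is étale-local (Stacks 07ZA with 00U0)

Topic: `Literature/RingTheory/FittingIdeal`. For an `A`-algebra `B` and a formally étale
`B`-algebra `B'` (an étale neighbourhood, a localisation, a henselisation, the completion of an
excellent local ring along a separable residue field, …), `Ω_{B'/A} = B' ⊗_B Ω_{B/A}` (Mathlib's
`KaehlerDifferential.tensorKaehlerEquivOfFormallyEtale`), so by base change of Fitting ideals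
(`Module.fittingIdeal_baseChange`, `BaseChange.lean`) the ideals of the singular schemes agree:

* `Module.fittingIdeal_kaehlerDifferential_of_formallyEtale` — **PROVED**:
  `Fitt_k(Ω_{B'/A}) = Fitt_k(Ω_{B/A}) B'` for `B → B'` formally étale and `Ω_{B/A}` finite.

This is the compatibility by which a scheme-theoretic invariant read on `V(Fitt₁ Ω_{X/S})` — de
Jong 1996, 2.21's `Sing(f)`, e.g. the thickness `n_T` of 3.4 (`Scheme.Hom.nodeThickness` in
`Literature/AlgebraicGeometry/Resolution`) — may be computed after passing to an étale
neighbourhood of the point (2.23: the finite étale `A → A'` realising the residue field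
extension, and the étale-local / formal model `A'[u, v]/(Q - h)` of 3.3).

## Sources

* The Stacks Project, Tag 07ZA (3) (Fitting ideals and base change), Tag 00U0/00UO
  (differentials along étale maps). [StacksProject]
* D. Eisenbud, *Commutative Algebra with a View Toward Algebraic Geometry*, GTM 150 (1995),
  Cor. 20.5. [Eisenbud1995]
-/

namespace Literature.RingTheory.FittingIdeal

universe u v w

open TensorProduct

/-- **The singular scheme is étale-local** (Stacks 07ZA (3) with 00UO): for an `A`-algebra `B`
with `Ω_{B/A}` finite and a formally étale `B`-algebra `B'`, `Fitt_k(Ω_{B'/A}) = Fitt_k(Ω_{B/A}) B'`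
— `Ω_{B'/A} ≅ B' ⊗_B Ω_{B/A}` (`KaehlerDifferential.tensorKaehlerEquivOfFormallyEtale`), Fitting
ideals are invariants of the module, and they commute with base change
(`Module.fittingIdeal_baseChange`). Localisations being formally étale, this contains the
localisation case below (`Module.fittingIdeal_kaehlerDifferential_of_isLocalization'`; combined with
a localisation of the base in `Module.fittingIdeal_kaehlerDifferential_isLocalization_isLocalization`,
`Localization.lean`).
[cite: StacksProject, Tag 07ZA] -/
theorem Module.fittingIdeal_kaehlerDifferential_of_formallyEtale {A : Type u} {B : Type v}
    {B' : Type w} [CommRing A] [CommRing B] [CommRing B'] [Algebra A B] [Algebra A B']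
    [Algebra B B'] [IsScalarTower A B B'] [Algebra.FormallyEtale B B']
    [Module.Finite B (Ω[B⁄A])] (k : ℕ) :
    Module.fittingIdeal B' (Ω[B'⁄A]) k =
      (Module.fittingIdeal B (Ω[B⁄A]) k).map (algebraMap B B') := by
  rw [← Module.fittingIdeal_eq_of_linearEquiv
      (KaehlerDifferential.tensorKaehlerEquivOfFormallyEtale A B B') k,
    Module.fittingIdeal_baseChange]

/-- In particular along a localisation `B → S⁻¹B` (formally étale):
`Fitt_k(Ω_{S⁻¹B/A}) = S⁻¹ Fitt_k(Ω_{B/A})`. [cite: StacksProject, Tag 07ZA] -/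
theorem Module.fittingIdeal_kaehlerDifferential_of_isLocalization' {A : Type u} {B : Type v}
    {B' : Type w} [CommRing A] [CommRing B] [CommRing B'] [Algebra A B] [Algebra A B']
    [Algebra B B'] [IsScalarTower A B B'] (S : Submonoid B) [IsLocalization S B']
    [Module.Finite B (Ω[B⁄A])] (k : ℕ) :
    Module.fittingIdeal B' (Ω[B'⁄A]) k =
      (Module.fittingIdeal B (Ω[B⁄A]) k).map (algebraMap B B') :=
  haveI : Algebra.FormallyEtale B B' := Algebra.FormallyEtale.of_isLocalization S
  Module.fittingIdeal_kaehlerDifferential_of_formallyEtale k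

end Literature.RingTheory.FittingIdeal
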